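import Mathlib

/-!
# LatticeQCDFlow / Scaling — the step-count optimum of out-of-equilibrium (Jarzynski) samplers

HONEST FRAMING: exact (Metropolis-corrected) sampling algorithms for lattice gauge theory;
figures of merit are autocorrelation/cost numbers at stated couplings and volumes; no
continuum-physics claim.

Venture `LatticeQCDFlow` (cell pub-lqcd), topic `Scaling`, item T2-F of HOME/THEORY-2.md §4,
landed by FANOUT row 31 from `HOME/THEORY-2-Sketch.lean` v1.4 (theory seat, farm-checked).
Non-equilibrium MCMC / stochastic normalizing flows (Caselle et al. 2016; Bonanno et al.,
arXiv:2510.25704) drive a configuration through `n` Jarzynski steps and reweight by `exp(−W)`;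
the printed law is `ESS(n) = exp(−c/n)` with `c = k′ · n_dof` EXTENSIVE in the number of
degrees of freedom (ibid. §3.1).  The cost per effectively independent configuration is then
`n / ESS(n) = n · exp(c/n)`.

* `nstep_cost_lower_bound` — `n · exp(c/n) ≥ e · c` for all `n > 0`: the optimal cost is LINEAR
  in `c ∝ V`, with constant `e · k′` — never sub-linear;
* `nstep_cost_eq_at_optimum` — equality at `n = c`, where `ESS = 1/e`
  (ibid. §4: "ESS_best = 1/e", architecture-independent); `nstep_ess_at_optimum`.

Pure real analysis (`Real.add_one_le_exp`); the law `ESS(n) = exp(−c/n)` itself is an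
empirical/perturbative input of the cited papers, not a theorem here.
-/

namespace Summit.Ventures.LatticeQCDFlow.Theory2

/-- **T2-F.**  If `ESS(n) = exp(−c/n)` for a protocol of `n` steps (Bonanno et al. 2026,
arXiv:2510.25704 §3.1: `c = k′·n_dof`, extensive), the cost per effectively independent
configuration `n/ESS(n) = n·exp(c/n)` is at least `e·c`, with equality at `n = c`, where
`ESS = 1/e` (ibid. §4, "ESS_best = 1/e, architecture-independent").  Hence the optimal cost is
LINEAR in `c ∝ n_dof ∝ V` — never better. [folklore] -/
theorem nstep_cost_lower_bound {c n : ℝ} (hc : 0 < c) (hn : 0 < n) :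
    Real.exp 1 * c ≤ n * Real.exp (c / n) := by
  have h1 : c / n ≤ Real.exp (c / n - 1) := by
    have := Real.add_one_le_exp (c / n - 1); linarith
  have h2 : Real.exp (c / n) = Real.exp 1 * Real.exp (c / n - 1) := by
    rw [← Real.exp_add]; congr 1; ring
  have h3 : Real.exp 1 * c = n * (Real.exp 1 * (c / n)) := by
    field_simp
  rw [h2, h3]
  exact mul_le_mul_of_nonneg_left (mul_le_mul_of_nonneg_left h1 (Real.exp_pos 1).le) hn.le

/-- The bound of `nstep_cost_lower_bound` is attained at `n = c`: `c · exp(c/c) = e · c`.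
[folklore] -/
theorem nstep_cost_eq_at_optimum {c : ℝ} (hc : c ≠ 0) : c * Real.exp (c / c) = Real.exp 1 * c := by
  rw [div_self hc, mul_comm]

/-- At the optimum `n = c` the ESS fraction is `exp(−c/c) = 1/e` (Bonanno et al. 2026 §4,
"ESS_best = 1/e"). [folklore] -/
theorem nstep_ess_at_optimum {c : ℝ} (hc : c ≠ 0) : Real.exp (-(c / c)) = (Real.exp 1)⁻¹ := by
  rw [div_self hc, Real.exp_neg]

end Summit.Ventures.LatticeQCDFlow.Theory2
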